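import Literature.AlgebraicGeometry.Frobenioids.FrobeniusConjugates
import Literature.AlgebraicGeometry.Frobenioids.NaiveFrobeniusFunctor
import HarnessLib

/-!
# Frobenioids I, §2: the naive Frobenius functor of a Frobenioid, unconditionally (Prop. 2.1 via Prop. 1.10 (i))

Mochizuki, *The geometry of Frobenioids I*, Kyushu J. Math. **62** (2008), Prop. 2.1, kurims p. 44
[cite: MochizukiFrdI2008, Prop. 2.1 p.44].  `NaiveFrobeniusFunctor.lean` builds the naive Frobenius
functor from the unique-lifting property `HasFrobeniusLifts F d` (= the conclusion of Prop. 1.10 (i));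
seat L1-t1's `FrobeniusConjugates.lean` proves Prop. 1.10 (i) for Frobenioids
(`existsUnique_frobeniusConjugate`, `degFr_frobeniusConjugate`, `div_frobeniusConjugate`).  This file
discharges the hypothesis — `hasFrobeniusLifts` — so that Prop. 2.1 (i), (ii) hold for every
Frobenioid with no extra hypothesis: `naiveFrobeniusOf hF d` and its properties.
-/

noncomputable section

namespace Literature.AlgebraicGeometry.Frobenioids

open CategoryTheory Opposite

universe w v v' u u'

namespace PreFrobenioid

variable {D : Type u} [Category.{v} D] {Φ : Dᵒᵖ ⥤ CommMonCat.{w}}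
  {C : Type u'} [Category.{v'} C] {F : C ⥤ ElemFrobenioid Φ}

/-- **Prop. 1.10 (i) ⇒ the lifting hypothesis of §2**: in a Frobenioid, morphisms lift uniquely along
pairs of morphisms of Frobenius type of the same degree, with the printed `deg_Fr` and `Div` formulas
(seat L1-t1's Prop. 1.10 (i)). [cite: MochizukiFrdI2008, Prop. 1.10(i) p.34] -/
theorem hasFrobeniusLifts (hF : IsFrobenioid F) (d : ℕ+) : HasFrobeniusLifts F d := by
  intro A B A' B' φ α β hα hαd hβ hβd
  have hd : degFr F α = degFr F β := hαd.trans hβd.symm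
  refine ⟨existsUnique_frobeniusConjugate hF φ hα hβ hd, fun φ' h => ⟨?_, ?_⟩⟩
  · exact degFr_frobeniusConjugate h hd
  · haveI : IsIso (Base F α) := hα.2
    rw [div_frobeniusConjugate h hα hβ, map_pow, ← pull_comp, IsIso.hom_inv_id, pull_id, hβd]

/-- **Prop. 2.1 (i)** for a Frobenioid, unconditionally: the naive Frobenius functor of degree `d`
(for the choice of morphisms of Frobenius type supplied by Def. 1.3 (ii)).
[cite: MochizukiFrdI2008, Prop. 2.1(i) p.44] -/
def naiveFrobeniusOf (hF : IsFrobenioid F) (d : ℕ+) : C ⥤ C :=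
  naiveFrobenius (nonempty_frobeniusChoice F hF d).some (hasFrobeniusLifts hF d)

/-- **Prop. 2.1 (i)**, well-definedness: for ANY two Frobenius choices of degree `d` the naive
Frobenius functors are isomorphic (no lifting hypothesis left). [cite: MochizukiFrdI2008, Prop. 2.1(i) p.44] -/
def naiveFrobeniusIsoOf (hF : IsFrobenioid F) {d : ℕ+} (ch ch' : FrobeniusChoice F d) :
    naiveFrobenius ch (hasFrobeniusLifts hF d) ≅ naiveFrobenius ch' (hasFrobeniusLifts hF d) :=
  naiveFrobeniusIso hF ch ch' (hasFrobeniusLifts hF d)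

/-- **Prop. 2.1 (i)**, composites: `Ψ_{d₂} ∘ Ψ_{d₁} ≅ Ψ_{d₁ d₂}` for a Frobenioid (no lifting hypothesis
left). [cite: MochizukiFrdI2008, Prop. 2.1(i) p.44] -/
theorem naiveFrobeniusOf_comp_iso (hF : IsFrobenioid F) (d₁ d₂ : ℕ+) :
    Nonempty (naiveFrobeniusOf hF d₁ ⋙ naiveFrobeniusOf hF d₂ ≅ naiveFrobeniusOf hF (d₁ * d₂)) :=
  naiveFrobenius_comp_iso hF _ _ _ _ _ _

/-- **Prop. 2.1 (ii)** for a Frobenioid, unconditionally: `Ψ` is `1`-compatible with the Frobenius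
functor of degree `d` on `F_Φ`. [cite: MochizukiFrdI2008, Prop. 2.1(ii) p.44] -/
theorem naiveFrobeniusOf_oneCommutes (hF : IsFrobenioid F) (d : ℕ+) :
    OneCommutes F (ElemFrobenioid.frobenius Φ d) (naiveFrobeniusOf hF d) F :=
  naiveFrobenius_oneCommutes _ _

/-- **Prop. 2.1 (ii)**, "Moreover", for a Frobenioid: on `O^▷(A)` of a Frobenius-normalized `A`, lifting
along a base-identity endomorphism of Frobenius type of degree `d` is the `d`-th power map.
[cite: MochizukiFrdI2008, Prop. 2.1(ii) p.44] -/
theorem frobeniusConjugate_endSubmonoid_eq_pow (hF : IsFrobenioid F) {A : C} (hA : IsFrobeniusNormalized F A)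
    (α : A ⟶ A) (hα : IsFrobeniusType F α) (hαb : IsBaseIdentity F α) (β : endSubmonoid F A)
    (β' : A ⟶ A) (hβ' : α ≫ β' = (show A ⟶ A from β.1) ≫ α) :
    β' = (show A ⟶ A from (β ^ (degFr F α : ℕ)).1) :=
  lift_endSubmonoid_eq_pow (hasFrobeniusLifts hF (degFr F α)) hA α hα rfl hαb β β' hβ'

end PreFrobenioid

end Literature.AlgebraicGeometry.Frobenioids
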